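import Summits.QuantumFields.GaugeBoot.DiagonalRPTorusColumns
import HarnessLib

/-!
# Closed-half diagonal RP FAILS on every odd three-torus, uniformly in the size
(gauge-boot, task L3(ν), 4/4)

HONEST FRAMING (cell `pub-gaugeboot`, page 1 of every file): the venture produces certified bounds
on lattice expectations at stated coupling, gauge group, dimension and torus size; NOT a mass gap,
NOT a continuum limit, NOT a string tension; NOT Yang–Mills-summit-bearing (barriers
`FixedCouplingUltralocality`, `PerturbativeInvisibility`). This module is a structural NEGATIVE
result about a positivity constraint on finite tori (`d = 3`, every odd `L ≥ 3`) for gauge groups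
carrying a sign character; it discharges nothing else.

## Content

`DiagonalRPTorusOdd` (task L3(θ)) proves closed-half diagonal reflection positivity
`DiagonalReflectionPositive ρ β i j` on EVERY odd two-torus, for every compact group and every
`β ≥ 0`; `DiagonalRPTorusNegativeThree` (L3(λ)) kills the `d = 3` analogue on `(ℤ/3)³` for
`β ≤ 1/2000`. Here:

* **`DiagRPThree.not_diagonalReflectionPositive_odd`** — for `d = 3`, EVERY odd `L ≥ 3`, the swap
  of the coordinates `0, 1`, every compact group `G`, every continuous one-dimensional
  representation `ρ` with values in `{1, -1}` attaining `-1`, and every `0 < β ≤ 1/10000` — ONE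
  window for all `L` —, `¬ DiagonalReflectionPositive (d := 3) (L := L) ρ β 0 1`;
* **`DiagRPThree.not_diagonalReflectionPositive_odd_intUnits`** — the `ℤ₂` lattice gauge theory
  instance (`G = ℤˣ`, `signRepIntUnits`), so the negative is not vacuous.

So the odd-torus route by which L3(ι) (`ClassBTwoDimensional`) transfers torus positivity to the
two-dimensional infinite-volume limit has no three-dimensional analogue at ANY torus size: at a
fixed small coupling every odd torus `(ℤ/L)³` violates closed-half diagonal RP.

## Mechanism

Write `L = 2c + 1`, `σ = Re tr ρ`, `P_A` for the Polyakov loop in the spectator direction `2`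
over the column `A ∈ (ℤ/L)²`, `θ(a,b) = (b,a)`. The columns `X = (c, 0)` and `Y = (-1, c)` lie at
diagonal level `c = (L-1)/2` (closed half); `θX = (0, c)` is ADJACENT to `Y` and `θY = (c, -1)`
is adjacent to `X`, while `θX, X` (and `θY, Y`) differ in both coordinates. With
`F = P_X - P_Y`, `DiagonalRPTorusSignExpansion.wilsonExpectation_polDiff` gives
`⟨(ΘF)‾ F⟩ ∝ K(θX,X) - K(θX,Y) - K(θY,X) + K(θY,Y)`, `K = ksum (tanh β)`. By the polymer bounds of
`DiagonalRPTorusPolymerBound`: the one-column ladders give `K(θX,Y), K(θY,X) ≥ t^L · 𝐙`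
(`ladder_boundary`, `pow_mul_ksum_le`), and since no plaquette contains links of two columns
differing in both coordinates, the `2L` column links are disjoint one-link cuts, every surface
with boundary `θX + X` has `≥ 2L` plaquettes (`two_mul_le_card`), so
`K(θX,X), K(θY,Y) ≤ (44t)^{2L} e^L · 𝐙` (`ksum_le_polymer`). For `t e 44² < 1` the combination is
negative, uniformly in `L`.

## What is NOT claimed

Nothing about `β > 1/10000`, nothing about even `L` (closed half: killed in `d ≥ 3` by
`DiagonalRPTorusNegative`; INNER half: the companion module `DiagonalRPTorusInnerHalfNegativeEven`),
nothing about groups without a sign character (e.g. `SU(N)`), nothing about infinite volume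
(diagonal RP on `ℤ³` / free boxes holds, `DiagonalRPFiniteVolume`; at small `β` the unique
infinite-volume state is diagonal-RP, `ClassBStrongCoupling`) — the theorem says the finite tori
themselves are not, so nothing is inherited from them.

Sources: Osterwalder–Seiler, Ann. Phys. 110 (1978) 440, §§2–3; Kazakov–Zheng, arXiv:2203.11360 §3.1
(the diagonal reflection family). Elementary; not in print as theorems as far as the cell's searches go.
Printed precedent (nearest-neighbour spin systems, a remark without proof): periodic boundary conditions destroy
diagonal RP — Fröhlich–Israel–Lieb–Simon, J. Stat. Phys. 22 (1980) 297, §3 (Model 3.1); M. Biskup, in LNM 1970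
(2009) §5.5; the statements here are theorem-level, gauge-theoretic forms of that obstruction (tribunal t2 F-R1).
-/

open MeasureTheory Complex Finset
open scoped ComplexOrder

namespace Summit.QuantumFields.GaugeBoot

open Literature.MathematicalPhysics.QuantumFieldTheory

namespace DiagRPThree

/-! ## The odd torus: columns, levels, and the sign of the combination -/

section Odd

variable {L : ℕ} [NeZero L]

/-- The witness columns on the odd torus `L = 2c + 1`: `X = (c, 0)` … -/
def colX (c : ℕ) : ZMod L × ZMod L := ((c : ZMod L), 0)

/-- … and `Y = (-1, c)`; `θX = (0, c)` is adjacent to `Y`, `θY = (c, -1)` to `X`. -/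
def colY (c : ℕ) : ZMod L × ZMod L := (-1, (c : ZMod L))

/-- `K(θX, Y) ≥ t^L 𝐙`: the ladder in the plane `(0,2)` over `Y` joins `Y` to `Y + e₀ = θX`. -/
theorem cross_lower_X {t : ℝ} (ht0 : 0 ≤ t) (ht1 : t ≤ 1) (c : ℕ) (C : ZMod L × ZMod L) :
    t ^ L * ksum t C C ≤ ksum t (colX (L := L) c).swap (colY c) := by
  have hb : bump (plane02.1.1) (colY (L := L) c) = (colX (L := L) c).swap := by
    simp [bump, plane02, colY, colX]
  have hlad := fun e => ladder_boundary (colY (L := L) c) plane02 rfl e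
  rw [hb] at hlad
  have h := pow_mul_ksum_le ht0 ht1 C hlad
  have hsymm : ksum t (colY (L := L) c) (colX c).swap = ksum t (colX (L := L) c).swap (colY c) := by
    unfold ksum jind
    simp only [add_right_comm]
  rw [← hsymm]
  refine le_trans ?_ h
  exact mul_le_mul_of_nonneg_right (pow_le_pow_of_le_one ht0 ht1 (card_ladder_le _ _))
    (ksum_nonneg ht0 _ _)

/-- `K(θY, X) ≥ t^L 𝐙`: the ladder in the plane `(1,2)` over `θY` joins `θY` to `θY + e₁ = X`. -/
theorem cross_lower_Y {t : ℝ} (ht0 : 0 ≤ t) (ht1 : t ≤ 1) (c : ℕ) (C : ZMod L × ZMod L) :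
    t ^ L * ksum t C C ≤ ksum t (colY (L := L) c).swap (colX c) := by
  have hb : bump (plane12.1.1) (colY (L := L) c).swap = colX (L := L) c := by
    simp [bump, plane12, colY, colX]
  have hlad := fun e => ladder_boundary (colY (L := L) c).swap plane12 rfl e
  rw [hb] at hlad
  exact le_trans (mul_le_mul_of_nonneg_right (pow_le_pow_of_le_one ht0 ht1 (card_ladder_le _ _))
    (ksum_nonneg ht0 _ _)) (pow_mul_ksum_le ht0 ht1 C hlad)

omit [NeZero L] in
/-- On the odd torus `L = 2c+1 ≥ 3`, `c ≠ 0` and `c ≠ -1` in `ℤ/L`. -/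
theorem coe_c_ne (c : ℕ) (hL : L = 2 * c + 1) (hc : 1 ≤ c) :
    (c : ZMod L) ≠ 0 ∧ (c : ZMod L) ≠ -1 := by
  constructor
  · intro h
    rw [ZMod.natCast_eq_zero_iff] at h
    have := Nat.le_of_dvd (by omega) h
    omega
  · intro h
    have h' : ((c + 1 : ℕ) : ZMod L) = 0 := by
      push_cast
      rw [h, neg_add_cancel]
    rw [ZMod.natCast_eq_zero_iff] at h'
    have := Nat.le_of_dvd (by omega) h'
    omega

/-- `K(θX, X) ≤ (44t)^{2L} e^L 𝐙`: `θX = (0,c)` and `X = (c,0)` differ in both coordinates. -/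
theorem diag_upper_X {t : ℝ} (ht0 : 0 ≤ t) (ht1 : t ≤ 1 / 44) (c : ℕ) (hL : L = 2 * c + 1)
    (hc : 1 ≤ c) (C : ZMod L × ZMod L) :
    ksum t (colX (L := L) c).swap (colX c) ≤ (44 * t) ^ (2 * L) * Real.exp L * ksum t C C := by
  obtain ⟨hc0, -⟩ := coe_c_ne (L := L) c hL hc
  refine ksum_le_polymer (fun S hS => two_mul_le_card ?_ ?_ hS) ht0 ht1 C
  · simpa [colX] using hc0.symm
  · simpa [colX] using hc0

/-- `K(θY, Y) ≤ (44t)^{2L} e^L 𝐙`: `θY = (c,-1)` and `Y = (-1,c)` differ in both coordinates. -/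
theorem diag_upper_Y {t : ℝ} (ht0 : 0 ≤ t) (ht1 : t ≤ 1 / 44) (c : ℕ) (hL : L = 2 * c + 1)
    (hc : 1 ≤ c) (C : ZMod L × ZMod L) :
    ksum t (colY (L := L) c).swap (colY c) ≤ (44 * t) ^ (2 * L) * Real.exp L * ksum t C C := by
  obtain ⟨-, hc1⟩ := coe_c_ne (L := L) c hL hc
  refine ksum_le_polymer (fun S hS => two_mul_le_card ?_ ?_ hS) ht0 ht1 C
  · simpa [colY] using hc1
  · simpa [colY] using hc1.symm

/-- **The sign of the combination**, uniformly in `L ≥ 1`: for `0 < t ≤ 1/6000`,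
`(44t)^{2L} e^L < t^L` (since `44² e t < 1`), hence
`K(θX,X) - K(θX,Y) - K(θY,X) + K(θY,Y) < 0`. -/
theorem combination_neg {t : ℝ} (ht0 : 0 < t) (ht1 : t ≤ 1 / 6000) (c : ℕ) (hL : L = 2 * c + 1)
    (hc : 1 ≤ c) :
    ksum t (colX (L := L) c).swap (colX c) - ksum t (colX (L := L) c).swap (colY c) -
        ksum t (colY (L := L) c).swap (colX c) + ksum t (colY (L := L) c).swap (colY c) < 0 := by
  have hL1 : 1 ≤ L := by omega
  set Z := ksum t (colX (L := L) c) (colX c) with hZ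
  have hZpos : 0 < Z := by
    -- the empty surface is closed: `𝐙 ≥ t^0 = 1`
    have h := pow_card_le_ksum (L := L) (t := t) ht0.le (A := colX c) (B := colX c) (S₀ := ∅)
      (fun e => by unfold degS; rw [sum_empty, zero_add, ← two_mul]; exact even_two_mul _)
    rw [card_empty, pow_zero] at h
    linarith
  have ht44 : t ≤ 1 / 44 := by linarith
  have h1 := diag_upper_X ht0.le ht44 c hL hc (colX (L := L) c)
  have h2 := diag_upper_Y ht0.le ht44 c hL hc (colX (L := L) c)
  have h3 := cross_lower_X ht0.le (by linarith) c (colX (L := L) c)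
  have h4 := cross_lower_Y ht0.le (by linarith) c (colX (L := L) c)
  -- `(44 t)^{2L} e^L < t^L`
  have hsmall : (44 * t) ^ (2 * L) * Real.exp L < t ^ L := by
    have he := Real.exp_one_lt_d9
    have hq : 44 ^ 2 * t * Real.exp 1 < 1 := by
      nlinarith [mul_le_mul_of_nonneg_right ht1 (Real.exp_pos 1).le, Real.exp_pos 1]
    have hq0 : 0 ≤ 44 ^ 2 * t * Real.exp 1 := by positivity
    have hexp : Real.exp L = Real.exp 1 ^ L := by
      rw [← Real.exp_nat_mul, mul_one]
    rw [hexp, pow_mul, ← mul_pow]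
    calc ((44 * t) ^ 2 * Real.exp 1) ^ L = (t * (44 ^ 2 * t * Real.exp 1)) ^ L := by ring
      _ < (t * 1) ^ L := by
          refine pow_lt_pow_left₀ ?_ (by positivity) (by omega)
          exact mul_lt_mul_of_pos_left hq ht0
      _ = t ^ L := by rw [mul_one]
  nlinarith

/-! ## The theorem -/

variable {G : Type*} [Group G] [TopologicalSpace G] [IsTopologicalGroup G] [CompactSpace G]
  [MeasurableSpace G] [BorelSpace G] {ρ : G →* Matrix (Fin 1) (Fin 1) ℂ}

omit [TopologicalSpace G] [IsTopologicalGroup G] [CompactSpace G] [MeasurableSpace G]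
  [BorelSpace G] in
/-- The witness `P_X - P_Y` is an observable of the CLOSED diagonal half
`{0 ≤ (x₀ - x₁) mod L ≤ L/2}`: both columns `X = (c,0)`, `Y = (-1,c)` lie at level `c = (L-1)/2`. -/
theorem isDiagonalHalfObservable_polDiff_odd (c : ℕ) (hL : L = 2 * c + 1) :
    IsDiagonalHalfObservable (0 : Fin 3) 1
      (polDiff ρ (colX (L := L) c) (colY c) : GaugeConfig 3 L G → ℂ) := by
  have hlev : ((c : ZMod L)).val ≤ L / 2 := by
    rw [ZMod.val_natCast, Nat.mod_eq_of_lt (by omega)]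
    omega
  have hY : (-1 : ZMod L) - (c : ZMod L) = (c : ZMod L) := by
    have h : ((2 * c + 1 : ℕ) : ZMod L) = 0 := by rw [← hL, ZMod.natCast_self]
    push_cast at h
    linear_combination -h
  intro U V hUV
  have key : ∀ A : ZMod L × ZMod L, A.1 - A.2 = (c : ZMod L) →
      ∀ e : Edge 3 L, ccnt A e ≠ 0 → U e = V e := by
    intro A hA e he
    obtain ⟨h2, h0, h1⟩ := ccnt_ne_zero he
    refine hUV e ?_ ?_
    · rw [h0, h1, hA]
      exact hlev
    · rw [h2, WilsonRP.shift_apply_of_ne e.1 (show (0 : Fin 3) ≠ 2 by decide),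
        WilsonRP.shift_apply_of_ne e.1 (show (1 : Fin 3) ≠ 2 by decide), h0, h1, hA]
      exact hlev
  exact polDiff_congr _ _ fun e he =>
    he.elim (key (colX c) (by simp [colX]) e) (key (colY c) (by simpa [colY] using hY) e)

/-- **L3(ν): closed-half diagonal reflection positivity FAILS on every odd three-torus,
uniformly.** For every odd `L ≥ 3`, every compact group `G`, every continuous one-dimensional
representation `ρ` with values in `{1, -1}` attaining `-1` (a sign character) and every coupling
`0 < β ≤ 1/10000` (a window independent of `L`), the torus transplant
`DiagonalReflectionPositive (d := 3) (L := L) ρ β 0 1` of closed-half-space diagonal RP — which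
L3(θ) proves in `d = 2` for all odd `L ≥ 3`, all compact `G`, all continuous `ρ`, all `β ≥ 0` —
is FALSE. Witness: `F = P_{(c,0)} - P_{(-1,c)}`, `L = 2c+1`, a difference of two Polyakov loops
in the spectator direction; `⟨(ΘF)‾ F⟩_{Λ,β} < 0` by the polymer bounds (cross terms `≥ t^L 𝐙`,
diagonal terms `≤ (44t)^{2L} e^L 𝐙`, `t = tanh β`). -/
theorem not_diagonalReflectionPositive_odd (hLodd : Odd L) (h3 : 3 ≤ L) (hρ : Continuous ρ)
    (hval : ∀ g, ρ g = 1 ∨ ρ g = -1) (hne : ∃ g, ρ g = -1) {β : ℝ} (hβ : 0 < β)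
    (hβ1 : β ≤ 1 / 10000) :
    ¬ DiagonalReflectionPositive (d := 3) (L := L) ρ β 0 1 := by
  obtain ⟨c, hc⟩ := hLodd
  have hc1 : 1 ≤ c := by omega
  intro hRP
  have ht0 : 0 < Real.tanh β := by
    rw [Real.tanh_eq_sinh_div_cosh]
    exact div_pos (Real.sinh_pos_iff.2 hβ) (Real.cosh_pos β)
  have ht1 : Real.tanh β ≤ 1 / 6000 := by
    have h := tanh_le_add_sq hβ.le (by linarith)
    nlinarith [mul_le_mul hβ1 hβ1 hβ.le (by norm_num : (0 : ℝ) ≤ 1 / 10000)]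
  exact not_nonneg_wilsonExpectation_polDiff hρ hval hne β (colX (L := L) c) (colY c)
    (combination_neg ht0 ht1 c hc hc1)
    (hRP _ (measurable_polDiff hρ _ _) ⟨2, norm_polDiff_le hval _ _⟩
      (isDiagonalHalfObservable_polDiff_odd c hc))

/-- **`ℤ₂` lattice gauge theory violates closed-half diagonal RP on every odd three-torus**
`(ℤ/L)³`, `L ≥ 3` odd, for every `0 < β ≤ 1/10000`: the theorem
`not_diagonalReflectionPositive_odd` is not vacuous (`G = ℤˣ`, `ρ = signRepIntUnits`). -/
theorem not_diagonalReflectionPositive_odd_intUnits (hLodd : Odd L) (h3 : 3 ≤ L) {β : ℝ}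
    (hβ : 0 < β) (hβ1 : β ≤ 1 / 10000) :
    ¬ DiagonalReflectionPositive (d := 3) (L := L) signRepIntUnits β 0 1 :=
  not_diagonalReflectionPositive_odd hLodd h3 continuous_of_discreteTopology
    signRepIntUnits_eq_one_or ⟨-1, signRepIntUnits_neg_one⟩ hβ hβ1

end Odd

end DiagRPThree

end Summit.QuantumFields.GaugeBoot
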